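import Summits.BirchSwinnertonDyer.Rank1Residual.Additive.TypeGIntegralJ
import Summits.BirchSwinnertonDyer.Rank1Residual.AdditivePotMult.PStarTwistModel
import Summits.BirchSwinnertonDyer.Rank1Residual.AdditivePotMult.TwistSupplyJClass
import Literature.NumberTheory.EllipticCurves.Delbourgo2002.PAdicBSDLeadingTerm
import Literature.NumberTheory.EllipticCurves.SelmerInftyTorsionFiniteProofs
import Mathlib.NumberTheory.RamificationInertia.Valuation
import HarnessLib

/-!
# The (M) locus and Delbourgo 2002: the BRIDGE from the sub-cell predicate `PotMult` to the named fact
# `Delbourgo2002.mainTheorem_potMult`, and the `ℓ`-free exact rank-`0` leading term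
# (cell `b2b-bsdres`, team n1011, seat p16, sub-target T-N10M)

HONEST FRAMING (cell `b2b-bsdres`, run/shared/lean/b2b/bsd-rank1-residual/, verbatim in every
file): the goal of the cell is to DELETE the COMBINATION-SHAPED residual classes of the
Birch–Swinnerton-Dyer formula for ALL analytic-rank `≤ 1` elliptic curves over `ℚ` — "full BSD
formula for every rank `≤ 1` curve in class `C`" assembled STRICTLY from published theorems — so
that the rank-`≤ 1` remainder becomes exactly the CONSTRUCTION-SHAPED classes, which are TYPED
(missing-input `Prop`s), NOT attempted. This is not "finishing BSD". Team n1011 (N10 / N11):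
research route; prove what is provable now; no claim beyond the stated classes; X3♯(M) / X4(M) stay
CONSTRUCTION-SHAPED; labels UNCHANGED; nothing booked. Theorems only (no definition, no named fact
minted here; the one Literature input is the explicit binder `hDelM`).

## What and why

The residual map's item N10 on the potentially MULTIPLICATIVE locus (M) (`AdditivePotMult.PotMult W p`:
additive at `p`, `ord_p j(E) < 0`; classes X3♯(M) = `ClassX3M`, X4(M) = `ClassX4M`) is the LOWER half
`ord_p #Ш_an ≤ ord_p #Ш` in rank `0`; the team types it ONCE in Iwasawa currency at `T = 0`
(`Additive.CycLowerLeadingTermAt` / the lead's ruling 2026-08-21T05:00Z) and reduces it to Miller's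
currency through an EXACT algebraic leading term at the additive prime. D. Delbourgo, J. Number
Theory 95 (2002) Main Theorem (A)+(B) IS such an exact leading term, in EVERY rank; its potentially
good ordinary case is the tree's `Delbourgo2002.mainTheorem` (A175, additive-p2 gen 18), and its
potentially multiplicative case — where the local factor is `ℓ_p(E) = 1` (p. 39) — is the named fact
`Delbourgo2002.mainTheorem_potMult` (this seat, same clause shape `LeadingTermClauses`). This file is
the kernel BRIDGE from the cell's predicate to that fact:

* §1 geometry: a potentially multiplicative pair has NO place of good reduction above `p` over any
  number field (`padicValRat_j_nonneg_of_hasGoodReductionAt_baseChange`, Silverman *AEC* VII.5.5 via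
  additive-p2's `valuation_j_le_one_of_hasGoodReductionAt`), so Delbourgo's anomalous proviso
  `ReductionNonAnomalous W p` is VACUOUS on (M) (`PotMult.reductionNonAnomalous`) and the clause
  factor `ℓ` is `1`; and the Hypothesis (p. 39: potentially ordinary at `p ≥ 5`, or at `p = 3` with
  semistable reduction over a quadratic extension of `ℚ₃`) is witnessed at EVERY odd `p` by the
  multiplicative twist `E^{(p*)}` (`PotMult.exists_quadraticTwist_mult` ⇐ additive-p1's
  `PotMult.mult_quadraticTwist_pStar`).
* §2 the bridge `PotMult.delbourgo2002`: on `PotMult W p`, `p ≠ 2`, the fact applies with every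
  hypothesis discharged (no CM by `PotMult.not_hasCM`); (A) `PotMult.isTorsion_of_delbourgo2002`;
  (B) at `r_E = 0`, `ℓ`-free: `PotMult.constantCoeff_of_delbourgo2002` —
  `fE(0) · #E(ℚ)_{tors}² = u · #Ш[p^∞] · ∏_ℓ c_ℓ`, `u ∈ ℤ_p^×`, for every generator `fE` of `char_Λ X(E/ℚ_∞)`;
  class wrappers `ClassX4M.delbourgo2002`, `ClassX3M.delbourgo2002` (no image hypothesis anywhere).

Consumers (other seats, by the team's one-owner rule): the Miller-currency reductions on (M) (n1011
p18 / p07: `CycLeadingTermDvdAt` / `CycLowerLeadingTermAt` ⟹ `Typed.MissingLowerBoundAt`, and the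
iff), and the rank-`1` strand (n1011 p01, O7-ord on X4(M), which takes `LeadingTermClauses W p Dh` +
the Schneider binder). What this file does NOT do: it proves no lower bound for any curve (the typed
`T = 0` inputs are OPEN: Delbourgo 1998 Main Conjecture (M), Compositio 113 p. 151; the
`ω^{(p−1)/2}`-branch of the multiplicative twist's cyclotomic IMC, lower direction, printed nowhere —
additive-p1 ENDSTATE), books nothing and changes no label.

References: D. Delbourgo, J. Number Theory 95 (2002) 38–71, Hypothesis and `ℓ_p(E)` (p. 39), Theorem
(A), (B) (p. 40), Example (p. 40), p. 61, p. 69 [Delbourgo2002]; J. H. Silverman, *AEC* VII.5 Prop. 5.5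
[SilvermanAEC2009]; *ATAEC* V.5.3 [SilvermanATAEC1994].
-/

noncomputable section

open scoped Classical NumberField

open WeierstrassCurve NumberField IsDedekindDomain IsDedekindDomain.HeightOneSpectrum
  Literature.NumberTheory.EllipticCurves
  Literature.NumberTheory.EllipticCurves.Rank1Residual

namespace Summit.BirchSwinnertonDyer.Rank1Residual.AdditivePotMult

open Additive

variable {W : WeierstrassCurve ℚ} {p : ℕ} [hp : Fact p.Prime]

/-! ### §1 Geometry of (M): no good place above `p` -/

/-- **Good reduction above `p` over SOME number field forces `ord_p j(E) ≥ 0`** (Silverman *AEC*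
VII.5.5; additive-p2's `valuation_j_le_one_of_hasGoodReductionAt` for a single place `w ∣ p` of a
single number field `F`, descended to `ℚ` by Mathlib's `valuation_liesOver`).
[cite: SilvermanAEC2009, VII.5 Prop. 5.5] -/
theorem padicValRat_j_nonneg_of_hasGoodReductionAt_baseChange (W : WeierstrassCurve ℚ) [W.IsElliptic]
    (p : ℕ) [hp : Fact p.Prime] (F : Type*) [Field F] [NumberField F]
    (w : HeightOneSpectrum (𝓞 F)) (hw : (p : 𝓞 F) ∈ w.asIdeal)
    (hgood : (W.baseChange F).HasGoodReductionAt w) : 0 ≤ padicValRat p W.j := by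
  by_cases hj0 : W.j = 0
  · simp [hj0]
  haveI : (W.baseChange F).IsElliptic := by rw [baseChange]; infer_instance
  have hjw := valuation_j_le_one_of_hasGoodReductionAt (W.baseChange F) w hgood
  have hjF : (W.baseChange F).j = algebraMap ℚ F W.j := W.map_j (algebraMap ℚ F)
  rw [hjF] at hjw
  -- the place of `ℤ` below `w` is `(p)`
  set v : HeightOneSpectrum ℤ := (Rat.HeightOneSpectrum.primesEquiv (R := ℤ)).symm ⟨p, hp.out⟩
    with hvdef
  have hv : Rat.HeightOneSpectrum.natGenerator v = p :=
    congrArg Subtype.val ((Rat.HeightOneSpectrum.primesEquiv (R := ℤ)).apply_symm_apply ⟨p, hp.out⟩)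
  have hunder : w.asIdeal.under ℤ = v.asIdeal := by
    have hle : v.asIdeal ≤ w.asIdeal.under ℤ := by
      rw [Rat.HeightOneSpectrum.asIdeal_eq_span_natGenerator_int, hv, Ideal.span_le,
        Set.singleton_subset_iff, SetLike.mem_coe, Ideal.under_def, Ideal.mem_comap, map_natCast]
      exact hw
    exact (v.isMaximal.eq_of_le (Ideal.IsPrime.ne_top inferInstance) hle).symm
  haveI : w.asIdeal.LiesOver v.asIdeal := ⟨hunder.symm⟩
  have he : v.asIdeal.ramificationIdx' w.asIdeal ≠ 0 :=
    Ideal.IsDedekindDomain.ramificationIdx'_ne_zero_of_liesOver w.asIdeal v.ne_bot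
  have hvj : v.valuation ℚ W.j ≤ 1 := by
    rw [← pow_le_one_iff he, valuation_liesOver (K := ℚ) (L := F) v w W.j]
    exact hjw
  rw [Rat.HeightOneSpectrum.valuation_eq_exp_neg_padicValRat v hj0, hv, ← WithZero.exp_zero,
    WithZero.exp_le_exp] at hvj
  linarith

/-- **On (M) Delbourgo's anomalous proviso is VACUOUS**: a potentially multiplicative pair
(`ord_p j(E) < 0`) has NO place of good reduction above `p` over any subfield of any `p`-th cyclotomic
field (indeed over any number field), so `Delbourgo2002.ReductionNonAnomalous W p` holds trivially —
whence the factor `ℓ` of the leading-term clauses is `1`, as printed (`ℓ_p(E) := 1` when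
`ord_p j_E < 0`, J. Number Theory 95 (2002) p. 39). [cite: Delbourgo2002, p. 39 (definition of ℓ_p(E))]
[cite: SilvermanAEC2009, VII.5 Prop. 5.5] -/
theorem PotMult.reductionNonAnomalous [W.IsElliptic] (hpm : PotMult W p) :
    Delbourgo2002.ReductionNonAnomalous W p := by
  intro L _ _ _ F w hw hgood
  haveI : NumberField F := NumberField.of_module_finite ℚ F
  exact absurd (padicValRat_j_nonneg_of_hasGoodReductionAt_baseChange W p F w hw hgood)
    (not_le.mpr hpm.2)

/-- **On (M) Delbourgo's Hypothesis holds at EVERY odd `p`, in the typed form**: the quadratic twist by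
`p* = (−1)^{(p−1)/2} p` has multiplicative reduction at `p` (additive-p1's
`PotMult.mult_quadraticTwist_pStar`, gen 6) — so `E` "attains multiplicative reduction after taking a
suitable field extension" (p. 38: potentially ordinary) and, at `p = 3`, has "semistable reduction over
a quadratic extension of `ℚ₃`" (p. 39), namely over the ramified quadratic field `ℚ_p(√p*)`.
[cite: Delbourgo2002, Hypothesis (p. 39) and p. 38] -/
theorem PotMult.exists_quadraticTwist_mult [W.IsElliptic] (hpm : PotMult W p) (hp2 : p ≠ 2) :
    ∃ d : ℚ, d ≠ 0 ∧ (W.quadraticTwist d).HasMultiplicativeReductionAtPrime p :=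
  ⟨(-1 : ℚ) ^ (p / 2) * p,
    mul_ne_zero (pow_ne_zero _ (by norm_num)) (Nat.cast_ne_zero.mpr hp.out.ne_zero),
    hpm.mult_quadraticTwist_pStar hp2⟩

/-! ### §2 THE BRIDGE: on the cell's (M) predicate the named fact applies with every hypothesis discharged -/

/-- **The bridge (M) ⟶ Delbourgo 2002.** For a globally minimal `W` and an odd prime `p` with
`PotMult W p` (additive at `p`, `ord_p j < 0` — the sub-cell predicate of X3♯(M)/X4(M)), the named fact
`Delbourgo2002.mainTheorem_potMult` applies with ALL its hypotheses discharged in the kernel: no CM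
(`PotMult.not_hasCM`: CM `j`-invariants are integers), additivity (`PotMult.1`), `ord_p j < 0`
(`PotMult.2`), the twist witness (`PotMult.exists_quadraticTwist_mult`). Output: (A) `X(E/ℚ_∞)` is
`Λ`-torsion for every dual datum of the cyclotomic tower, and (B) some `p`-adic height datum satisfies
`Delbourgo2002.LeadingTermClauses W p Dh` (ANY rank; the rank-`1` strand consumes this form, the factor
`ℓ` being `1` by `PotMult.reductionNonAnomalous`). [cite: Delbourgo2002, Theorem (A), (B) (p. 40), Hypothesis (p. 39)] -/
theorem PotMult.delbourgo2002 [W.IsElliptic] [W.IsGloballyMinimal]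
    (hDelM : Delbourgo2002.mainTheorem_potMult) (hpm : PotMult W p) (hp2 : p ≠ 2) :
    (∀ (κ : ZpExtension ℚ p) (γ : Field.absoluteGaloisGroup ℚ),
        κ.IsCyclotomic → κ.IsTopGenerator γ → ∀ D : W.SelmerDualData κ γ, D.IsTorsion) ∧
    ∃ Dh : PAdicHeightData W p, Delbourgo2002.LeadingTermClauses W p Dh :=
  hDelM W p hp2 hpm.not_hasCM hpm.1 hpm.2 (hpm.exists_quadraticTwist_mult hp2)

/-- (A) on (M): `X(E/ℚ_∞)` is `Λ`-torsion (every dual datum of the cyclotomic `ℤ_p`-extension with a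
topological generator). [cite: Delbourgo2002, Theorem (A) (p. 40)] -/
theorem PotMult.isTorsion_of_delbourgo2002 [W.IsElliptic] [W.IsGloballyMinimal]
    (hDelM : Delbourgo2002.mainTheorem_potMult) (hpm : PotMult W p) (hp2 : p ≠ 2)
    {κ : ZpExtension ℚ p} {γ : Field.absoluteGaloisGroup ℚ} (hκ : κ.IsCyclotomic)
    (hγ : κ.IsTopGenerator γ) (D : W.SelmerDualData κ γ) : D.IsTorsion :=
  (hpm.delbourgo2002 hDelM hp2).1 κ γ hκ hγ D

/-- **Rank `0` on (M): the EXACT algebraic leading term, `ℓ`-free.** For `W` globally minimal with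
`PotMult W p`, `p` odd, `E(ℚ)` finite and `Ш(E/ℚ)[p^∞]` finite: for the cyclotomic `κ, γ` (with `γ`
matching the cyclotomic variable), every dual datum `D` and every generator `fE` of `char_Λ X(E/ℚ_∞)`,
`ord_{T=0} fE = 0` and **`fE(0) · #E(ℚ)_{tors}² = u · #Ш(E/ℚ)[p^∞] · ∏_ℓ c_ℓ`** with `u ∈ ℤ_p^×` — Delbourgo
2002 Theorem (B) at `r_E = 0` with `ℓ_p(E) = 1` (the clause's factor `ℓ` killed by
`PotMult.reductionNonAnomalous`). This is the identity the N10 (M) lower-half consumers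
(`Additive.CycLowerLeadingTermAt` / `CycLeadingTermDvdAt` ⟹ `Typed.MissingLowerBoundAt`) start from;
`c_p ∈ {2,4}` is a `p`-adic unit here (Kodaira `I_n^*`), so the product may equally be taken over
`ℓ ≠ p`. [cite: Delbourgo2002, Theorem (B) (p. 40), ℓ_p(E) = 1 (p. 39), p. 69] -/
theorem PotMult.constantCoeff_of_delbourgo2002 [W.IsElliptic] [W.IsGloballyMinimal]
    (hDelM : Delbourgo2002.mainTheorem_potMult) (hpm : PotMult W p) (hp2 : p ≠ 2)
    [Finite W.toAffine.Point] (hfin : Finite (AddCommGroup.primaryComponent W.sha p))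
    {κ : ZpExtension ℚ p} {γ : Field.absoluteGaloisGroup ℚ} (hκ : κ.IsCyclotomic)
    (hγ : κ.IsTopGenerator γ) (hγ' : IsCyclotomicVariable p γ) (D : W.SelmerDualData κ γ)
    {fE : IwasawaAlgebra p} (hf : D.charIdeal = Ideal.span {fE}) :
    fE.order = 0 ∧ ∃ u : ℤ_[p]ˣ,
      ((PowerSeries.constantCoeff fE : ℤ_[p]) : ℚ_[p]) * (W.torsionOrder : ℚ_[p]) ^ 2 =
        ((u : ℤ_[p]) : ℚ_[p]) *
          ((Nat.card (AddCommGroup.primaryComponent W.sha p) : ℚ_[p]) * W.tamagawaProduct) := by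
  haveI : Module.Finite (IwasawaAlgebra p) D.X :=
    SelmerDualData.module_finite_of_isCyclotomic (W := W) (κ := κ) hκ D hγ
  obtain ⟨hA, Dh, hB⟩ := hpm.delbourgo2002 hDelM hp2
  have hX : D.IsTorsion := hA κ γ hκ hγ D
  obtain ⟨horder, u, ℓ, -, hℓ1, heq⟩ := hB.constantCoeff hκ hγ hγ' D hX hf hfin
  refine ⟨horder, u, ?_⟩
  rw [hℓ1 hpm.reductionNonAnomalous, Nat.cast_one, mul_one] at heq
  exact heq

/-- **X4(M) bridge**: the class X4(M) (`ClassX4 ∧ PotMult`, `p` odd by `ClassX4`) meets every hypothesis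
of `Delbourgo2002.mainTheorem_potMult`. [cite: Delbourgo2002, Theorem (A), (B) (p. 40)] -/
theorem ClassX4M.delbourgo2002 [W.IsElliptic] [W.IsGloballyMinimal]
    (hDelM : Delbourgo2002.mainTheorem_potMult) (hX : ClassX4M W p) :
    (∀ (κ : ZpExtension ℚ p) (γ : Field.absoluteGaloisGroup ℚ),
        κ.IsCyclotomic → κ.IsTopGenerator γ → ∀ D : W.SelmerDualData κ γ, D.IsTorsion) ∧
    ∃ Dh : PAdicHeightData W p, Delbourgo2002.LeadingTermClauses W p Dh :=
  hX.potMult.delbourgo2002 hDelM hX.p_ne_two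

/-- **X3♯(M) bridge**: the class X3♯(M) (`ClassX3 ∧ PotMult ∧ p ≠ 2`) meets every hypothesis of
`Delbourgo2002.mainTheorem_potMult` (no image hypothesis in the source: reducible `E[p]` allowed).
[cite: Delbourgo2002, Theorem (A), (B) (p. 40)] -/
theorem ClassX3M.delbourgo2002 [W.IsElliptic] [W.IsGloballyMinimal]
    (hDelM : Delbourgo2002.mainTheorem_potMult) (hX : ClassX3M W p) :
    (∀ (κ : ZpExtension ℚ p) (γ : Field.absoluteGaloisGroup ℚ),
        κ.IsCyclotomic → κ.IsTopGenerator γ → ∀ D : W.SelmerDualData κ γ, D.IsTorsion) ∧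
    ∃ Dh : PAdicHeightData W p, Delbourgo2002.LeadingTermClauses W p Dh :=
  hX.potMult.delbourgo2002 hDelM hX.p_ne_two

end Summit.BirchSwinnertonDyer.Rank1Residual.AdditivePotMult

end
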